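import Literature.Analysis.FluidPDE.ElgindiSliceBoundary
import HarnessLib

/-!
# Uniform moduli at the angular boundary and joint continuity of boundary extensions
([Elgindi2021] §7.1: boundary behaviour of the weak solution)

Topic `Literature/Analysis/FluidPDE`. Proof file (everything proved, no definitions, no named
facts) on the proof path of the named fact
`Literature.Analysis.FluidPDE.Elgindi.ElgindiGhoulMasmoudi2021_stabilityCore`
(`ElgindiStabilityDecomposition.lean`). T. M. Elgindi, Ann. of Math. 194 (2021) =
arXiv:1904.04795, §7.1 Proposition 7.1 (p. 19 of the held text).

Elementary real analysis used to pass from slice information to joint statements at the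
angular boundary of the strip:
* `sq_le_mul_integral_of_tendsto_zero_left/right`: if `y → 0` at an endpoint and `y′ ∈ L²`, then
  `y(θ)² ≤ dist(θ, endpoint)·∫ y′²`;
* `sq_sub_le_mul_integral`: the `½`-Hölder modulus `(y θ₁ − y θ₂)² ≤ |θ₁ − θ₂| ∫ y′²`;
* `exists_tendsto_rate_of_holder`: a uniform `½`-Hölder modulus near `0⁺` gives a limit with the
  rate `|y θ − L| ≤ M√θ`;
* `continuousOn_boundary_value`, `continuousWithinAt_extension`: a family `G(R,·)` converging to
  `g₀(R)` as `θ → 0⁺` at a rate uniform in `R`, with `G` continuous inside, has `g₀` continuous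
  and the extension by `g₀` jointly continuous up to `θ = 0`.
-/

noncomputable section

open MeasureTheory Set Real Filter Function
open _root_.Topology

namespace Literature.Analysis.FluidPDE

namespace Elgindi

/-! ### Cauchy–Schwarz moduli from `y′ ∈ L²` -/

/-- **The `½`-Hölder modulus**: `(y θ₂ − y θ₁)² ≤ (θ₂ − θ₁)∫_{(a,b)} y′²` for `a < θ₁ ≤ θ₂ < b`. [folklore] -/
theorem sq_sub_le_mul_integral {y y' : ℝ → ℝ} {a b : ℝ} (hy : ∀ θ ∈ Ioo a b, HasDerivAt y (y' θ) θ)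
    (hy'c : ContinuousOn y' (Ioo a b)) (hI : IntegrableOn (fun θ => y' θ ^ 2) (Ioo a b))
    {θ₁ θ₂ : ℝ} (h₁ : θ₁ ∈ Ioo a b) (h₂ : θ₂ ∈ Ioo a b) (h12 : θ₁ ≤ θ₂) :
    (y θ₂ - y θ₁) ^ 2 ≤ (θ₂ - θ₁) * ∫ θ in Ioo a b, y' θ ^ 2 := by
  have hsub : Icc θ₁ θ₂ ⊆ Ioo a b := fun x hx => ⟨h₁.1.trans_le hx.1, hx.2.trans_lt h₂.2⟩
  have hc : ContinuousOn y' (Icc θ₁ θ₂) := hy'c.mono hsub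
  have hftc : y θ₂ - y θ₁ = ∫ x in θ₁..θ₂, y' x :=
    (intervalIntegral.integral_eq_sub_of_hasDerivAt (fun x hx => hy x (hsub (by rwa [uIcc_of_le h12] at hx)))
      (hc.intervalIntegrable_of_Icc h12)).symm
  have hCS := sq_intervalIntegral_le_on hc h12
  have hmono : ∫ x in θ₁..θ₂, y' x ^ 2 ≤ ∫ θ in Ioo a b, y' θ ^ 2 := by
    rw [intervalIntegral.integral_of_le h12, integral_Ioc_eq_integral_Ioo]
    exact setIntegral_mono_set hI (ae_of_all _ fun θ => sq_nonneg _)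
      (Eventually.of_forall fun x hx => ⟨h₁.1.trans hx.1, hx.2.trans h₂.2⟩)
  rw [hftc]
  exact hCS.trans (mul_le_mul_of_nonneg_left hmono (by linarith))

/-- **Decay at the left endpoint**: if moreover `y → 0` at `a⁺`, then `y(θ)² ≤ (θ − a)∫ y′²`. [folklore] -/
theorem sq_le_mul_integral_of_tendsto_zero_left {y y' : ℝ → ℝ} {a b : ℝ} (hy : ∀ θ ∈ Ioo a b, HasDerivAt y (y' θ) θ)
    (hy'c : ContinuousOn y' (Ioo a b)) (hI : IntegrableOn (fun θ => y' θ ^ 2) (Ioo a b))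
    (h0 : Tendsto y (𝓝[>] a) (𝓝 0)) {θ : ℝ} (hθ : θ ∈ Ioo a b) :
    y θ ^ 2 ≤ (θ - a) * ∫ t in Ioo a b, y' t ^ 2 := by
  -- pass to the limit `θ₁ → a⁺` in the Hölder modulus
  have hev : ∀ᶠ θ₁ in 𝓝[>] a, (y θ - y θ₁) ^ 2 ≤ (θ - θ₁) * ∫ t in Ioo a b, y' t ^ 2 := by
    rw [← nhdsWithin_Ioo_eq_nhdsGT hθ.1]
    filter_upwards [self_mem_nhdsWithin] with θ₁ hθ₁
    exact sq_sub_le_mul_integral hy hy'c hI ⟨hθ₁.1, hθ₁.2.trans hθ.2⟩ hθ hθ₁.2.le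
  have hl : Tendsto (fun θ₁ => (y θ - y θ₁) ^ 2) (𝓝[>] a) (𝓝 ((y θ - 0) ^ 2)) := ((tendsto_const_nhds.sub h0).pow 2)
  have hr : Tendsto (fun θ₁ => (θ - θ₁) * ∫ t in Ioo a b, y' t ^ 2) (𝓝[>] a) (𝓝 ((θ - a) * ∫ t in Ioo a b, y' t ^ 2)) :=
    ((tendsto_const_nhds.sub (tendsto_id.mono_left nhdsWithin_le_nhds)).mul_const _)
  have := le_of_tendsto_of_tendsto hl hr hev
  simpa using this

/-- **Decay at the right endpoint**: if `y → 0` at `b⁻`, then `y(θ)² ≤ (b − θ)∫ y′²`. [folklore] -/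
theorem sq_le_mul_integral_of_tendsto_zero_right {y y' : ℝ → ℝ} {a b : ℝ} (hy : ∀ θ ∈ Ioo a b, HasDerivAt y (y' θ) θ)
    (hy'c : ContinuousOn y' (Ioo a b)) (hI : IntegrableOn (fun θ => y' θ ^ 2) (Ioo a b))
    (h1 : Tendsto y (𝓝[<] b) (𝓝 0)) {θ : ℝ} (hθ : θ ∈ Ioo a b) :
    y θ ^ 2 ≤ (b - θ) * ∫ t in Ioo a b, y' t ^ 2 := by
  have hev : ∀ᶠ θ₂ in 𝓝[<] b, (y θ₂ - y θ) ^ 2 ≤ (θ₂ - θ) * ∫ t in Ioo a b, y' t ^ 2 := by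
    rw [← nhdsWithin_Ioo_eq_nhdsLT hθ.2]
    filter_upwards [self_mem_nhdsWithin] with θ₂ hθ₂
    exact sq_sub_le_mul_integral hy hy'c hI hθ ⟨hθ.1.trans hθ₂.1, hθ₂.2⟩ hθ₂.1.le
  have hl : Tendsto (fun θ₂ => (y θ₂ - y θ) ^ 2) (𝓝[<] b) (𝓝 ((0 - y θ) ^ 2)) := ((h1.sub tendsto_const_nhds).pow 2)
  have hr : Tendsto (fun θ₂ => (θ₂ - θ) * ∫ t in Ioo a b, y' t ^ 2) (𝓝[<] b) (𝓝 ((b - θ) * ∫ t in Ioo a b, y' t ^ 2)) :=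
    (((tendsto_id.mono_left nhdsWithin_le_nhds).sub tendsto_const_nhds).mul_const _)
  have := le_of_tendsto_of_tendsto hl hr hev
  simpa using this

/-! ### Limits with a rate from a uniform Hölder modulus -/

/-- **Limit with a rate**: if `|y θ₂ − y θ₁| ≤ M√(θ₂ − θ₁)` for `0 < θ₁ ≤ θ₂ < c` and `y` has a
limit `L` at `0⁺`, then `|y θ − L| ≤ M√θ` on `(0,c)`. [folklore] -/
theorem abs_sub_lim_le_of_holder {y : ℝ → ℝ} {c M L : ℝ}
    (hH : ∀ θ₁ θ₂, θ₁ ∈ Ioo 0 c → θ₂ ∈ Ioo 0 c → θ₁ ≤ θ₂ → |y θ₂ - y θ₁| ≤ M * Real.sqrt (θ₂ - θ₁))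
    (hL : Tendsto y (𝓝[>] 0) (𝓝 L)) {θ : ℝ} (hθ : θ ∈ Ioo 0 c) : |y θ - L| ≤ M * Real.sqrt θ := by
  have hev : ∀ᶠ θ₁ in 𝓝[>] (0:ℝ), |y θ - y θ₁| ≤ M * Real.sqrt (θ - θ₁) := by
    rw [← nhdsWithin_Ioo_eq_nhdsGT hθ.1]
    filter_upwards [self_mem_nhdsWithin] with θ₁ hθ₁
    exact hH θ₁ θ ⟨hθ₁.1, hθ₁.2.trans hθ.2⟩ hθ hθ₁.2.le
  have hl : Tendsto (fun θ₁ => |y θ - y θ₁|) (𝓝[>] 0) (𝓝 |y θ - L|) := (tendsto_const_nhds.sub hL).abs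
  have hr : Tendsto (fun θ₁ => M * Real.sqrt (θ - θ₁)) (𝓝[>] 0) (𝓝 (M * Real.sqrt (θ - 0))) :=
    ((tendsto_const_nhds.sub (tendsto_id.mono_left nhdsWithin_le_nhds)).sqrt.const_mul M)
  have := le_of_tendsto_of_tendsto hl hr hev
  simpa using this

/-! ### Joint continuity of boundary extensions from a uniform rate -/

section joint

variable {G : ℝ → ℝ → ℝ} {g₀ : ℝ → ℝ} {md : ℝ → ℝ} {a b c : ℝ}

/-- **The boundary value is continuous**: if `|G(R,θ) − g₀(R)| ≤ md(θ)` for `R ∈ (a,b)`,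
`θ ∈ (0,c)`, with `md → 0` at `0⁺`, and every slice `R ↦ G(R,θ)` (`θ ∈ (0,c)`) is continuous on
`(a,b)`, then `g₀` is continuous on `(a,b)`. [folklore] -/
theorem continuousOn_boundary_value (hc : 0 < c) (hrate : ∀ R ∈ Ioo a b, ∀ θ ∈ Ioo 0 c, |G R θ - g₀ R| ≤ md θ)
    (hmd : Tendsto md (𝓝[>] 0) (𝓝 0)) (hsl : ∀ θ ∈ Ioo 0 c, ContinuousOn (fun R => G R θ) (Ioo a b)) :
    ContinuousOn g₀ (Ioo a b) := by
  intro R₀ hR₀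
  rw [Metric.continuousWithinAt_iff]
  intro ε hε
  -- choose `θ` with `ω θ < ε/3`, then `δ` from the continuity of the slice
  have hωev : ∀ᶠ θ in 𝓝[>] (0:ℝ), |md θ| < ε / 3 := by
    have := (Metric.tendsto_nhds.1 hmd) (ε / 3) (by positivity)
    filter_upwards [this] with θ hθ; simpa [Real.dist_eq] using hθ
  have hmem : ∀ᶠ θ in 𝓝[>] (0:ℝ), θ ∈ Ioo 0 c := Ioo_mem_nhdsGT hc
  obtain ⟨θ, hωθ, hθ⟩ := (hωev.and hmem).exists
  obtain ⟨δ, hδ, hδG⟩ := (Metric.continuousWithinAt_iff.1 (hsl θ hθ R₀ hR₀)) (ε / 3) (by positivity)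
  refine ⟨δ, hδ, fun R hR hdist => ?_⟩
  have h1 := hrate R hR θ hθ
  have h2 := hrate R₀ hR₀ θ hθ
  have h3 := hδG hR hdist
  rw [Real.dist_eq] at h3 ⊢
  have hω' : md θ < ε / 3 := (le_abs_self _).trans_lt hωθ
  calc |g₀ R - g₀ R₀| = |(g₀ R - G R θ) + (G R θ - G R₀ θ) + (G R₀ θ - g₀ R₀)| := by ring_nf
    _ ≤ |g₀ R - G R θ| + |G R θ - G R₀ θ| + |G R₀ θ - g₀ R₀| := abs_add_three _ _ _
    _ < ε / 3 + ε / 3 + ε / 3 := by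
        gcongr
        · rw [abs_sub_comm]; exact h1.trans_lt hω'
        · exact h2.trans_lt hω'
    _ = ε := by ring

/-- **Joint continuity at the boundary**: under the same hypotheses, with `G` jointly continuous
on `(a,b) × (0,c)`, the function equal to `g₀(R)` on `θ = 0` and to `G(R,θ)` for `θ > 0` is
continuous on `(a,b) × [0,c)` (within). [folklore] -/
theorem continuousOn_extension (hc : 0 < c) (hrate : ∀ R ∈ Ioo a b, ∀ θ ∈ Ioo 0 c, |G R θ - g₀ R| ≤ md θ)
    (hmd : Tendsto md (𝓝[>] 0) (𝓝 0)) (hG : ContinuousOn (uncurry G) (Ioo a b ×ˢ Ioo 0 c)) :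
    ContinuousOn (fun p : ℝ × ℝ => if p.2 ≤ 0 then g₀ p.1 else G p.1 p.2) (Ioo a b ×ˢ Ico 0 c) := by
  have hsl : ∀ θ ∈ Ioo 0 c, ContinuousOn (fun R => G R θ) (Ioo a b) := fun θ hθ =>
    hG.comp (continuous_id.prodMk continuous_const).continuousOn fun R hR => ⟨hR, hθ⟩
  have hg₀ := continuousOn_boundary_value hc hrate hmd hsl
  intro p hp
  obtain ⟨hp1, hp2⟩ := hp
  rcases hp2.1.lt_or_eq with hpos | hzero
  · -- interior point: locally the function is `G`
    have hpS : p ∈ Ioo a b ×ˢ Ioo 0 c := ⟨hp1, hpos, hp2.2⟩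
    have hGp : ContinuousWithinAt (uncurry G) (Ioo a b ×ˢ Ico 0 c) p := by
      have h := (hG p hpS).continuousAt ((isOpen_Ioo.prod isOpen_Ioo).mem_nhds hpS)
      exact h.continuousWithinAt
    refine hGp.congr_of_eventuallyEq ?_ ?_
    · have hev : ∀ᶠ q in 𝓝[Ioo a b ×ˢ Ico 0 c] p, (0:ℝ) < q.2 :=
        mem_nhdsWithin_of_mem_nhds ((isOpen_lt continuous_const continuous_snd).mem_nhds hpos)
      filter_upwards [hev] with q hq
      simp only [uncurry, not_le.2 hq, if_false]
    · simp only [uncurry, not_le.2 hpos, if_false]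
  · -- boundary point `p = (R₀, 0)`
    rw [Metric.continuousWithinAt_iff]
    intro ε hε
    have hωev : ∀ᶠ θ in 𝓝[>] (0:ℝ), |md θ| < ε / 2 := by
      have := (Metric.tendsto_nhds.1 hmd) (ε / 2) (by positivity)
      filter_upwards [this] with θ hθ; simpa [Real.dist_eq] using hθ
    obtain ⟨θ₀, hθ₀, hθ₀sub⟩ := (mem_nhdsGT_iff_exists_Ioo_subset).1 (hωev.and (Ioo_mem_nhdsGT hc))
    obtain ⟨δ₁, hδ₁, hδ₁g⟩ := (Metric.continuousWithinAt_iff.1 (hg₀ p.1 hp1)) (ε / 2) (by positivity)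
    refine ⟨min δ₁ θ₀, lt_min hδ₁ hθ₀, fun q hq hdist => ?_⟩
    have hq1 : q.1 ∈ Ioo a b := hq.1
    have hdq : dist q p < δ₁ := hdist.trans_le (min_le_left _ _)
    have hdq' : dist q p < θ₀ := hdist.trans_le (min_le_right _ _)
    have hd1 : dist q.1 p.1 < δ₁ := (by simpa using Prod.dist_eq (x := q) (y := p) ▸ le_max_left (dist q.1 p.1) (dist q.2 p.2) : dist q.1 p.1 ≤ dist q p).trans_lt hdq
    have hgq : dist (g₀ q.1) (g₀ p.1) < ε / 2 := hδ₁g hq1 hd1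
    have hval_p : (if p.2 ≤ 0 then g₀ p.1 else G p.1 p.2) = g₀ p.1 := by
      simp only [← hzero, le_refl, if_true]
    rw [hval_p]
    rcases hq.2.1.lt_or_eq with hqpos | hqzero
    · have hq2 : q.2 ∈ Ioo 0 θ₀ := by
        refine ⟨hqpos, ?_⟩
        have : dist q.2 p.2 < θ₀ := (by simpa using Prod.dist_eq (x := q) (y := p) ▸ le_max_right (dist q.1 p.1) (dist q.2 p.2) : dist q.2 p.2 ≤ dist q p).trans_lt hdq'
        rw [← hzero, Real.dist_eq, sub_zero, abs_of_pos hqpos] at this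
        exact this
      have hq2c : q.2 ∈ Ioo 0 c := (hθ₀sub hq2).2
      have hωq : md q.2 < ε / 2 := (le_abs_self _).trans_lt (hθ₀sub hq2).1
      simp only [not_le.2 hqpos, if_false]
      calc dist (G q.1 q.2) (g₀ p.1) ≤ dist (G q.1 q.2) (g₀ q.1) + dist (g₀ q.1) (g₀ p.1) := dist_triangle _ _ _
        _ < ε / 2 + ε / 2 := by
            gcongr
            rw [Real.dist_eq]; exact (hrate q.1 hq1 q.2 hq2c).trans_lt hωq
        _ = ε := by ring
    · simp only [← hqzero, le_refl, if_true]
      linarith [hgq]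

end joint

end Elgindi

end Literature.Analysis.FluidPDE
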